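import Summits.BirchSwinnertonDyer.Rank1Residual.Additive.X3BranchDegenerateEndStateClasses
import Summits.BirchSwinnertonDyer.Rank1Residual.Additive.X3BranchCertificateRoadGord
import Summits.BirchSwinnertonDyer.Rank1Residual.Additive.CensusQ6UnitCoeffCertificate
import Summits.BirchSwinnertonDyer.Rank1Residual.Partition.EisensteinKernelCertificate
import Literature.NumberTheory.EllipticCurves.Rank1Residual.GVParityLineTypeProofs
import Literature.NumberTheory.EllipticCurves.AnalyticRankOrderProofs
import Literature.NumberTheory.DiophantineGeometry.AbcWave0UniformABCProofs
import HarnessLib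

/-!
# X3, the DEGENERATE rows at `p = 3`, rank `0`: the per-pair DISPLAY KIT
# (cell `bsd-eis`, seat `bsd-eis-x3` gen 6; sequel of `X3BranchDegenerateEndStateClasses.lean`;
# route K1 `AdditiveBranchIMC`, crux `GordTwoRankZeroOffCaseOne` — supports only)

HONEST FRAMING (`run/shared/lean/pub/bsd-eis/README.md` §4): the programme's target of record is the
full Birch–Swinnerton-Dyer formula for every `E/ℚ` of analytic rank `≤ 1`; this file concerns the
DEGENERATE X3♯(G-ord, `e = 2`) rows at `p = 3` only (`W[3]^{ss} = 1 ⊕ ω`: the member with a rational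
point of order `3`). THEOREMS ONLY; nothing is booked; no label, tier or count of record moves here.

The end state `ClassX3Gord.bsdp_three_rankZero_degenerate_of_facts_of_torsionFact_of_classes` is put in
the shape a per-pair display file can feed with kernel-checked data only:
* §1 `nsmul_eq_zero_of_zsmul_toGeomPoints_eq_zero`, `exists_trivialLine_of_ratPoint` — a rational point `(x₀, y₀)` with `Ψ₃(x₀) = 0 ≠ Ψ₂Sq(x₀)` spans
  the TRIVIAL rational `3`-line `Φ₀` (`IsRationalLine`, fixed pointwise by `Γ_ℚ`);
* §1 `ClassX3Gord.unitCoeffCert_three_zero_of_unitLValue` — the unit-coefficient certificate at index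
  `0` on every twist model from ONE datum `L(W,1) = q·Ω_W`, `ord₃ q = 0` (`e = 2` is automatic at `3`);
* §2 small arithmetic helpers for `Σ₀` (`natCast_mem_primesEquiv_symm`,
  `primesEquiv_dvd_of_natCast_mem`, `eq_or_eq_of_prime_dvd_mul_pow`);
* §3 `ClassX3Gord.bsdp_three_degenerate_display` — `BSD₃(W)` from the 11 PUBLISHED records of the end
  state, ONE Cremona datum `hL`, and per-pair KERNEL data: the class predicate, `Σ₀` with its local
  table, the rational `3`-torsion point, the primes `T ⊆ Σ₀` with `ℓ ≡ 1 (3)`, and `k` certified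
  `Σ₀`-units, under the arithmetic `Σδ + 1 ≤ #T + k`.
References: [GreenbergVatsal2000] §2 pp. 26–30; [GreenbergLNM1716] §3; [MazurTateTeitelbaum1986Invent]
§I.10, §I.13; [SilvermanAEC2009] III.2.3, Ex. 3.7; [Cassels1986] Ch. 4 Lemma 3.1.
-/

set_option autoImplicit false

noncomputable section

open scoped Classical AddSubgroup

namespace Summit.BirchSwinnertonDyer.Rank1Residual.Additive

open WeierstrassCurve NumberField IsDedekindDomain Field
  Literature.NumberTheory.EllipticCurves
  Literature.NumberTheory.EllipticCurves.ModularForms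
  Literature.NumberTheory.EllipticCurves.GreenbergSelmer
  Literature.NumberTheory.EllipticCurves.GreenbergVatsal2000
  Literature.NumberTheory.EllipticCurves.Rank1Residual
  Literature.NumberTheory.EllipticCurves.Rank1Residual.Typed
  Literature.NumberTheory.GaloisRepresentations
  Summit.BirchSwinnertonDyer.Rank1Residual.X1.MuLambda
  Summit.BirchSwinnertonDyer.Rank1Residual.AdditivePotMult
  Summit.BirchSwinnertonDyer.Rank1Residual.Additive.X3Branch

namespace X3DegenerateDisplayKit

/-! ### §1 The trivial line of a rational `3`-torsion point; the certificate from a unit `L`-value -/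

/-- For `P ∈ E(K)`: `n • P = O` in `E(K̄)` forces `n • P = O` in `E(K)` (the inclusion `toGeomPoints`
is an injective homomorphism). General field, classical decidability (the instance `toGeomPoints`
is additive for); over `ℚ` use it through `convert`. [folklore] -/
theorem nsmul_eq_zero_of_zsmul_toGeomPoints_eq_zero {K : Type*} [Field K] (W : WeierstrassCurve K)
    (P : W.toAffine.Point) {n : ℕ} (h : (n : ℤ) • W.toGeomPoints P = 0) : n • P = 0 := by
  apply toGeomPoints_injective W
  rw [map_nsmul, map_zero, ← natCast_zsmul, h]


/-- **A rational point of order `3` spans the TRIVIAL rational `3`-line.** For `(x₀, y₀) ∈ W(ℚ)` with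
`Ψ₃(x₀) = 0` and `Ψ₂Sq(x₀) ≠ 0` the point has order `3` in `E(ℚ̄)` (`KernelDisc.three_smul_eq_zero_of_eval_Ψ₃`,
through `E(ℚ) ↪ E(ℚ̄)`), so `Φ₀ = ℤ·(x₀, y₀) ≤ W[3]` is a rational line fixed pointwise by `Γ_ℚ`
(`exists_isRationalLine_of_nsmul_eq_zero`). [cite: SilvermanAEC2009, III.2.3, Ex. 3.7] -/
theorem exists_trivialLine_of_ratPoint {W : WeierstrassCurve ℚ} [W.IsElliptic] {x₀ y₀ : ℚ}
    (heq : y₀ ^ 2 + W.a₁ * x₀ * y₀ + W.a₃ * y₀ = x₀ ^ 3 + W.a₂ * x₀ ^ 2 + W.a₄ * x₀ + W.a₆)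
    (hψ : W.Ψ₃.eval x₀ = 0) (hd : W.Ψ₂Sq.eval x₀ ≠ 0) :
    ∃ Φ₀ : AddSubgroup (geomTorsion W ((3 : ℕ) : ℤ)), IsRationalLine W 3 Φ₀ ∧
      ∀ (σ : absoluteGaloisGroup ℚ) (P : geomTorsion W ((3 : ℕ) : ℤ)), P ∈ Φ₀ → σ • P = P := by
  haveI : Fact (Nat.Prime 3) := ⟨Nat.prime_three⟩
  have hns : W.toAffine.Nonsingular x₀ y₀ :=
    W.toAffine.equation_iff_nonsingular.mp ((Affine.equation_iff x₀ y₀).mpr heq)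
  have h' : (W.baseChange (AlgebraicClosure ℚ)).toAffine.Nonsingular
      (algebraMap ℚ (AlgebraicClosure ℚ) x₀) (algebraMap ℚ (AlgebraicClosure ℚ) y₀) :=
    (Affine.map_nonsingular _ (algebraMap ℚ (AlgebraicClosure ℚ)).injective x₀ y₀).mpr hns
  have hP0 : (Affine.Point.some x₀ y₀ hns : W.toAffine.Point) ≠ 0 := Affine.Point.some_ne_zero hns
  have e : W.toGeomPoints (Affine.Point.some x₀ y₀ hns) =
      (Affine.Point.some (algebraMap ℚ (AlgebraicClosure ℚ) x₀)
        (algebraMap ℚ (AlgebraicClosure ℚ) y₀) h' : W.geomPoints) := rfl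
  have hz : ((3 : ℕ) : ℤ) • W.toGeomPoints (Affine.Point.some x₀ y₀ hns) = 0 := by
    rw [e, Nat.cast_ofNat]
    exact KernelDisc.three_smul_eq_zero_of_eval_Ψ₃ hψ hd h'
  have h3 := nsmul_eq_zero_of_zsmul_toGeomPoints_eq_zero W _ hz
  obtain ⟨Φ, hΦ, hfix, -, -⟩ :=
    exists_isRationalLine_of_nsmul_eq_zero W (Affine.Point.some x₀ y₀ hns) hP0 (by convert h3)
  exact ⟨Φ, hΦ, hfix⟩

/-- **The unit-coefficient certificate at index `0` from a unit `L`-value, X3♯(G-ord) at `p = 3`.**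
`L(W,1) = q·Ω_W` with `q ≠ 0`, `ord₃ q = 0` gives the Q6 odd record at index `0`
(`CensusQ6.gordOddFirstUnitIndexAt_zero_of_unitLValue`), hence `X3BranchUnitCoeffCertAt V 3 0` on every
twist model `V` (`ClassX3Gord.unitCoeffCert_of_gordOddFirstUnitIndex`; `e = 2` at `3` by
`semistabilityIndex_eq_two_of_typeG_three`). [cite: MazurTateTeitelbaum1986Invent, §I.10 (10.1), §I.13] -/
theorem _root_.Summit.BirchSwinnertonDyer.Rank1Residual.Additive.ClassX3Gord.unitCoeffCert_three_zero_of_unitLValue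
    [Fact (Nat.Prime 3)] {W : WeierstrassCurve ℚ} [W.IsElliptic] [W.IsGloballyMinimal]
    (hmod : hasEntireLFunction_rat) (hX : ClassX3Gord W 3) {q : ℚ}
    (hL : W.entireLFunction 1 = (q : ℂ) * (W.realPeriodRat : ℂ)) (hq0 : q ≠ 0)
    (hv : padicValRat 3 q = 0)
    (V : WeierstrassCurve ℚ) [V.IsElliptic] [V.IsGloballyMinimal] (C : VariableChange ℚ)
    (hC : C • V.quadraticTwist ((-1) ^ ((3 : ℕ) / 2) * (3 : ℕ) : ℚ) = W) :
    X3BranchUnitCoeffCertAt V 3 0 :=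
  ClassX3Gord.unitCoeffCert_of_gordOddFirstUnitIndex hX
    (semistabilityIndex_eq_two_of_typeG_three W hX.typeGOrd.typeG hX.addv) (by decide)
    (CensusQ6.gordOddFirstUnitIndexAt_zero_of_unitLValue hmod (by decide) hX.addv hL hq0 hv) V C hC

/-! ### §2 Arithmetic of `Σ₀` -/

/-- `ℓ ∈ v_ℓ`. [folklore] -/
theorem natCast_mem_primesEquiv_symm (ℓ : ℕ) (hℓ : ℓ.Prime) :
    ((ℓ : ℕ) : 𝓞 ℚ) ∈ ((Rat.HeightOneSpectrum.primesEquiv (R := 𝓞 ℚ)).symm ⟨ℓ, hℓ⟩).asIdeal :=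
  (Literature.NumberTheory.Automorphic.BCDT.natCast_mem_asIdeal_iff_primesEquiv_eq _ hℓ).mpr
    (by rw [Equiv.apply_symm_apply])

/-- `a ∈ v ⟹ ℓ_v ∣ a`. [folklore] -/
theorem primesEquiv_dvd_of_natCast_mem (v : HeightOneSpectrum (𝓞 ℚ)) {a : ℕ}
    (h : ((a : ℕ) : 𝓞 ℚ) ∈ v.asIdeal) :
    (Rat.HeightOneSpectrum.primesEquiv (R := 𝓞 ℚ) v : ℕ) ∣ a :=
  (Literature.NumberTheory.DiophantineGeometry.UniformABCConjecture.natCast_mem_asIdeal_iff v a).mp h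

/-- A prime dividing `ℓ₁^m · ℓ₂^n` is `ℓ₁` or `ℓ₂`. [folklore] -/
theorem eq_or_eq_of_prime_dvd_mul_pow {q ℓ₁ ℓ₂ m n : ℕ} (hq : q.Prime) (h₁ : ℓ₁.Prime)
    (h₂ : ℓ₂.Prime) (h : q ∣ ℓ₁ ^ m * ℓ₂ ^ n) : q = ℓ₁ ∨ q = ℓ₂ := by
  rcases (Nat.Prime.dvd_mul hq).mp h with h | h
  · exact Or.inl ((Nat.prime_dvd_prime_iff_eq hq h₁).mp (hq.dvd_of_dvd_pow h))
  · exact Or.inr ((Nat.prime_dvd_prime_iff_eq hq h₂).mp (hq.dvd_of_dvd_pow h))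

/-! ### §3 The display end state -/

/-- **`BSD₃(W)` on a DEGENERATE X3♯(G-ord) row of rank `0` — DISPLAY SHAPE.** Displayed: the 11
PUBLISHED records of `ClassX3Gord.bsdp_three_rankZero_degenerate_of_facts_of_torsionFact_of_classes`
(verbatim) and ONE Cremona datum `hL : L(W,1) = q·Ω_W` (`q ≠ 0`, `ord₃ q = 0`: the unit row; it also
gives `r_an = 0`). KERNEL data per pair: `ClassX3Gord W 3`; `Σ₀ ∌ 3` non-empty with good reduction off
`Σ₀ ∪ {3}`; a rational point `(x₀, y₀)` with `Ψ₃(x₀) = 0 ≠ Ψ₂Sq(x₀)` (the trivial line `Φ₀`); primes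
`T`, `ℓ ≡ 1 (mod 3)`, under `Σ₀` (`3^{#T} ≤ #H¹`); `k` natural numbers `a_i` with `ℓ_i ∥ a_i`,
`ℓ_i ∤ a_j`, primes under `Σ₀`, `3 ∤ c_i`, `27 ∣ c_i³ − a_i` (`3^k ≤ #U`); and `Σδ + 1 ≤ #T + k`.
[cite: GreenbergVatsal2000, §2 pp. 26–30] [cite: GreenbergLNM1716, §3 p. 86]
[cite: MazurTateTeitelbaum1986Invent, §I.10 (10.1), §I.13] [cite: SilvermanAEC2009, III.2.3] -/
theorem _root_.Summit.BirchSwinnertonDyer.Rank1Residual.Additive.ClassX3Gord.bsdp_three_degenerate_display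
    [Fact (Nat.Prime 3)] {W : WeierstrassCurve ℚ} [W.IsElliptic] [W.IsGloballyMinimal]
    (hTors : Greenberg1999.finite_torsion_cyclotomicZpExtension)
    (hDelG : Delbourgo1998.prop4_rankZero_constantCoeff_eq_unit_mul_of_potGoodOrd)
    (hDel98 : Delbourgo1998.prop4_rankZero_pow_dvd_constantCoeff)
    (hGZK : rank_eq_analyticRank_of_analyticRank_le_one) (hmod : hasEntireLFunction_rat)
    (hmodD : nonempty_modularParametrizationData)
    (hW16 : Wuthrich2014.thm16_halfEigenCharIdeal_dvd_cyclotomicPrime)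
    (h23 : datumSelmer_nonPrimitive_invariants)
    (hRQ : datumSelmer_divisible_of_finite_torsionBy_of_gr_inertiaInvariants_eq_zero)
    (hGrK : Greenberg1999.imKummer_ge_strictCondition_goodOrdinary)
    (hLiftE : residualEpsilon_surjOn_of_lineEven)
    (hX : ClassX3Gord W 3) {q : ℚ} (hL : W.entireLFunction 1 = (q : ℂ) * (W.realPeriodRat : ℂ))
    (hq0 : q ≠ 0) (hv : padicValRat 3 q = 0)
    (S₀ : Finset (HeightOneSpectrum (𝓞 ℚ))) (hne : S₀.Nonempty)
    (hS₀ : ∀ v ∈ S₀, ((3 : ℕ) : 𝓞 ℚ) ∉ v.asIdeal)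
    (hS : ∀ v : HeightOneSpectrum (𝓞 ℚ), v ∉ S₀ → ((3 : ℕ) : 𝓞 ℚ) ∉ v.asIdeal →
      W.HasGoodReductionAt v)
    {x₀ y₀ : ℚ} (heq : y₀ ^ 2 + W.a₁ * x₀ * y₀ + W.a₃ * y₀ = x₀ ^ 3 + W.a₂ * x₀ ^ 2 + W.a₄ * x₀ + W.a₆)
    (hψ : W.Ψ₃.eval x₀ = 0) (hd : W.Ψ₂Sq.eval x₀ ≠ 0)
    (T : Finset ℕ) (hT : ∀ ℓ ∈ T, ℓ.Prime ∧ 3 ∣ ℓ - 1 ∧ ∃ v ∈ S₀, ((ℓ : ℕ) : 𝓞 ℚ) ∈ v.asIdeal)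
    {k : ℕ} (a ℓ : Fin k → ℕ) (c : Fin k → ℤ) (ha : ∀ i, a i ≠ 0) (hℓ : ∀ i, (ℓ i).Prime)
    (hval : ∀ i j, padicValNat (ℓ i) (a j) = if i = j then 1 else 0)
    (haS : ∀ i (v : HeightOneSpectrum (𝓞 ℚ)), ((a i : ℕ) : 𝓞 ℚ) ∈ v.asIdeal → v ∈ S₀)
    (hc : ∀ i, ¬ (3 : ℤ) ∣ c i) (hcube : ∀ i, (27 : ℤ) ∣ c i ^ 3 - a i)
    (hcount : ∑ v ∈ S₀, delta W 3 v + 1 ≤ T.card + k) :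
    BSDp W 3 := by
  -- `r_an = 0` from the non-vanishing `L`-value
  have hr : W.analyticRank = 0 := by
    refine (analyticRank_eq_zero_iff_holds (hmod _)).mpr ?_
    rw [hL]
    exact mul_ne_zero (by exact_mod_cast hq0) (by exact_mod_cast (realPeriodRat_pos_holds (W := W)).ne')
  -- the trivial rational line of the `3`-torsion point
  obtain ⟨Φ₀, hΦ, htriv⟩ := exists_trivialLine_of_ratPoint heq hψ hd
  refine ClassX3Gord.bsdp_three_rankZero_degenerate_of_facts_of_torsionFact_of_classes hTors hDelG hDel98
    hGZK hmod hmodD hW16 h23 hRQ hGrK hLiftE hX hr S₀ hne hS₀ hS Φ₀ hΦ htriv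
    (ClassX3Gord.unitCoeffCert_three_zero_of_unitLValue hmod hX hL hq0 hv) T hT a ℓ c ha hℓ
    (fun i j ↦ by convert hval i j) haS hc hcube ?_
  rwa [zero_add, Fintype.card_fin]

end X3DegenerateDisplayKit

end Summit.BirchSwinnertonDyer.Rank1Residual.Additive

end
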